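import Summits.Schanuel.Schanuel.Theorems.RootDecomp1KSectorTheorem08

/-!
# RootDecomp1KSectorTheorem — lens 1, generation 67, NODE 27 «THE SECTOR THEOREM BY ONE NEWTON STEP AT (∞,∞) — THE EDGE ENGINE» — FORK (B): the FIRST-ORDER SECTOR THEOREM at FLOOR F (`thinFibreAt_of_sectorCond : c k ≠ 0 → DomZero k c → SectorCond m₀ k c → ThinFibreAt m₀ (xPolyP k c)`, every m₀ / k / monomial support, the only escape the typed residue `Residue m₀ k c`; one PROVED Diophantine input `Ridout.padicRoth_int`; CLAIM L3031, PRICE L3032, ADDENDUM L3037, RULE K-R58, NODE L3047, VERDICT L3050) — continuation (RootDecomp1KSectorTheorem09): §11  THE RESIDUE BY NAME (F5/F6): the three strata ρ1 (SUBSPACE), ρ2 (MULTIPLE), ρ3 (PEELABLE-DEEP, the — 17 declarations `sectorCond_beta0_example` … `rho2_two`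

(lens-1 g67 NODE 27 «THE SECTOR THEOREM BY ONE NEWTON STEP AT (∞,∞) — THE EDGE ENGINE» L3047: HOME kernel K = HOME/decomp-schanuel-lens-1/g67/lean/SectorTheorem.lean sha256 bbe43d14…, 2869 l, ONE namespace `Summit.Schanuel.Schanuel.Theorems.RootDecomp1KSectorTheorem`, imports the tree port …RootDecomp1KDigitPincer03 ONLY (node 26's record port; its closure holds every cell file used); no private / instance / set_option / notation / sorry / new axiom / binder / `decide` on levels; lens farm rc 0 · 0 errors · 0 sorries · warnings dupNamespace only, `--axioms` standard on the 18 deciding declarations, Probe rc 0 (g67/out/); memo g67/NODE-g67.md; CLAIM L3031 (ASK-FIRST under K-R57 (iii)); crit g12 PRICE L3032 (fork (A) ×0-AS-RECORD as posted / fork (B) a kernel meeting FLOOR F = «FIRST-ORDER SECTOR THEOREM» = THEOREM ×1 consuming K-R57 (iii); CHECKLIST K-g67 F1–F6 + S1–S8; RULE K-R58 PRE-ANNOUNCED) and PRICE ADDENDUM L3037 ((F6′) `W4P` by tree name; the ρ3 specimen `x² + x·Y² + Y⁵ + 3` of writer NOTE 17 L3036 = the F5 exhibit); census instruments LIVENESS-v36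 (key edge) / v37 (key ls2); crit g12 VERDICT L3050 (2026-09-02T03:35Z): THEOREM ×1 GRANTED under K-R57 (iii) for FORK (B) = the FIRST-ORDER SECTOR THEOREM AT FLOOR F (F1 F2 F3 (T) F4(α) F4(β) F5 F6 F6′ R-27-i and CHECKLIST S1–S8 met on the critic's own farm runs), the single ×1 of the sector line CONSUMED (K-R58 (i): no further ×1 on this line), TALLY lens-1 ×22 + THEOREM ×24, RULE K-R58 FIXED (PRICE L3032 (i)–(v) verbatim with the ADDENDUM L3037 gloss; W-27-2 = a ×0 wish for typed stratum predicates), PORT GO → census-1 (this port; PORT IDENTITY 27 owed by the seated critic). Port by census-1 gen 25 as `RootDecomp1KSectorTheorem01–10` (files ≤ 400 lines; `--supports stmt-Schanuel-33364`, the item stays OPEN; no census credit carried; RULE K-R58 (iv): UNCONDITIONAL PART ∪= these names): 01 = K l.1–307 of the prepped source (opens §1 / §2 / §3) — 20 decls `dMax`, `box`, `supp`, …, `two_zpow_inj`; 02 = K l.308–570 of the prepped source (opens §4) — 5 decls `far_pair`, `natDegree_le_dMax`, `norm_pow_sub_one_le`, …, `mem_supp`; 03 = K l.571–896 of the prepped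 source (opens §4b / §5) — 12 decls `layered_bound`, `edge_bound_one`, `edge_bound_crude`, …, `tendsto_partialSum_two`; 04 = K l.897–1221 of the prepped source (opens §6 / §7) — 10 decls `arch_finite`, `ridout_two`, `lt_rpow_neg_of_pow_mul_pow_lt`, …, `factorial_pred_le_div`; 05 = K l.1222–1500 of the prepped source (opens §8) — 4 decls `pair_levels_finite`, `dvd_lc_pow_val`, `den_le_of_dvd`, `den_rescaled_le`; 06 = K l.1501–1822 of the prepped source (opens §9) — 13 decls `size_regime`, `c_zero_ne_zero`, `far_levels_finite`, …, `sum_range_ite_shift`; 07 = K l.1823–2080 of the prepped source (inside §9) — 14 decls `layerPoly_lin2`, `layer0_lin2`, `layer1_lin2`, …, `natDegree_scaleShift`; 08 = K l.2081–2407 of the prepped source (opens §10) — 18 decls `thinFibreAt_xLinear_sector`, `thinFibreAt_xPolyP_one`, `edgeGood_of_gap`, …, `thinFibreAt_M_sector`; 09 = K l.2408–2633 of the prepped source (opens §11) — 17 decls `sectorCond_beta0_example`, `thinFibreAt_beta0_example`, `thinFibreAt_generic_xLinear_example`, …, `rho2_two`; 10 = K l.2634–2911 of the prepped source (opens §12)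 — 13 decls `residue_rho2`, `rho3`, `rho3_zero`, …, `W4P_eq`. 39 one-line docstrings synthesised for undocumented helper declarations (statements quoted, census port convention since gen 22); FOUR port-side `private` modifiers forced by the gate's dedup.landed lint on the first filing of part 08 (p848905): `thinFibreAt_xLinear` (≡ tree `RootDecomp1KXLinear.thinFibreAt_xLinear`, XLinear05 l.187 — K's proof kept as PRIVATE `thinFibreAt_xLinear_sector`, later uses resolve to the tree theorem via a selective open), `thinFibreAt_X6P_sector` (≡ `RootDecomp1KDigitPincer.thinFibreAt_X6P`), `xc_zero'` / `xc_three'` (≡ `RootDecomp1KDigitPincer.xc_zero` / `xc_three`), each with the reason in its docstring; everything else = K VERBATIM (statements, names, proofs, K's module docstring kept in part 01 below this provenance block).)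
-/

noncomputable section

namespace Summit.Schanuel.Schanuel.Theorems.RootDecomp1KSectorTheorem

open Polynomial LiouvilleNumber
open scoped Nat
open Summit.Schanuel.Schanuel.Theorems.RootDecomp1KTwoBaseCell (psNumer partialSum_eq_psNumer_div coprime_psNumer)
open Summit.Schanuel.Schanuel.Theorems.RootDecomp1KRelLiouvilleCell (partialSum_two_strictMono
  abs_liouvilleNumber_two_sub_partialSum)
open Summit.Schanuel.Schanuel.Theorems.RootDecomp1KDegreeLadder
open Summit.Schanuel.Schanuel.Theorems.RootDecomp1KXLinear (xLinP bev_xLinP norm_ratCast_two norm_ratCast_of_le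
  norm_psNumer_sub_one)
open Summit.Schanuel.Schanuel.Theorems.RootDecomp1KDigitPincer (xc XP X6P)
open Summit.Schanuel.Schanuel.Theorems.RootDecomp1KOddEmpty (W4P w4C vG natDegree_vG)
open Summit.Schanuel.Schanuel.Theorems.RootDecomp1KHyperellipticSiegel (mQ mC mC_zero mC_one mC_two natDegree_mQ
  coeff_mQ_five leadingCoeff_mQ)
open Summit.Schanuel.Schanuel.Theorems.RootDecomp1KXLinearII (norm_aeval_le norm_psNumer)
open Summit.Schanuel.Schanuel.Theorems.RootDecomp1KXTop
open Summit.Schanuel.Schanuel.Theorems.RootDecomp1KXAll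
open Summit.Schanuel.Schanuel.Theorems.RootDecomp1KLevelFinite
open Summit.Schanuel.Schanuel.Theorems.RootDecomp1KLocalExponent
open Summit.Schanuel.Schanuel.Theorems.RootDecomp1KIntegrality
open Summit.Schanuel.Schanuel.Theorems.RootDecomp1KXLinear (thinFibreAt_xLinear)  -- port: the tree theorem whose statement K's F4 (α) repeats (dedup.landed p848905)

/-- **F6 / F2 BY EXAMPLE: `P = Y⁴ + Y³ + x·(Y² + Y + 1)`** — edge `f = W⁴ + W² = W²·(W² + 1)` (`s/q = 1/2`):
the root `W = 0` is NOT inspected (F2); the non-zero roots `±i` are simple and `f_1(±i) = (±i)³ + (±i) = 0` — the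
UNSHIFTED presentation already satisfies the sector condition (the pair is proportional: `A₃·B₂ = 1 = A₄·B₁`). -/
theorem sectorCond_beta0_example (m₀ : ℕ) : SectorCond m₀ 1 (lin2 (X ^ 4 + X ^ 3) (X ^ 2 + X + 1)) := by
  have hA : (X ^ 4 + X ^ 3 : ℤ[X]).natDegree = 4 := by compute_degree!
  have hB : (X ^ 2 + X + 1 : ℤ[X]).natDegree = 2 := by compute_degree!
  have hB0 : (X ^ 2 + X + 1 : ℤ[X]) ≠ 0 := by
    intro h
    rw [h, natDegree_zero] at hB
    omega
  refine sectorCond_lin2 _ _ hB0 hA hB (by norm_num) ?_ m₀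
  norm_num [coeff_add, coeff_X_pow, coeff_X, coeff_one]

/-- `(m₀ : ℕ) : ThinFibreAt m₀ (xLinP (X ^ 4 + X ^ 3) (X ^ 2 + X + 1))`. -/
theorem thinFibreAt_beta0_example (m₀ : ℕ) : ThinFibreAt m₀ (xLinP (X ^ 4 + X ^ 3) (X ^ 2 + X + 1)) := by
  have hA : (X ^ 4 + X ^ 3 : ℤ[X]).natDegree = 4 := by compute_degree!
  have hB : (X ^ 2 + X + 1 : ℤ[X]).natDegree = 2 := by compute_degree!
  have hB0 : (X ^ 2 + X + 1 : ℤ[X]) ≠ 0 := by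
    intro h
    rw [h, natDegree_zero] at hB
    omega
  exact thinFibreAt_xLinear _ _ hB0 (by rw [hA, hB]) m₀

/-- **F6: the GENERIC un-shifted `x`-linear member `A = Y⁴ + 2Y³`, `B = −17(Y² + 3Y)`** (stratum ρ3 of the residue
BEFORE the shift `Y ↦ Y + 1/2`; decided by F4 (α), which performs the shift). -/
theorem thinFibreAt_generic_xLinear_example (m₀ : ℕ) :
    ThinFibreAt m₀ (xLinP (X ^ 4 + C 2 * X ^ 3) (C (-17) * X ^ 2 + C (-51) * X)) := by
  have hA : (X ^ 4 + C 2 * X ^ 3 : ℤ[X]).natDegree = 4 := by compute_degree!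
  have hB : (C (-17) * X ^ 2 + C (-51) * X : ℤ[X]).natDegree = 2 := by compute_degree!
  have hB0 : (C (-17) * X ^ 2 + C (-51) * X : ℤ[X]) ≠ 0 := by
    intro h
    rw [h, natDegree_zero] at hB
    omega
  exact thinFibreAt_xLinear _ _ hB0 (by rw [hA, hB]) m₀

/-! ## §11  THE RESIDUE BY NAME (F5/F6): the three strata ρ1 (SUBSPACE), ρ2 (MULTIPLE), ρ3 (PEELABLE-DEEP, the
writer's specimen) — one PROVED member of `Residue 2` each (`2`-adic roots by Hensel) -/

/-- `aeval (a : ℤ_[2]) G = G.eval a` for `G ∈ ℤ[Y]`, `a ∈ ℤ`. -/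
theorem aeval_intCast_padicInt (G : ℤ[X]) (a : ℤ) : aeval (a : ℤ_[2]) G = ((G.eval a : ℤ) : ℤ_[2]) := by
  rw [← eq_intCast (algebraMap ℤ ℤ_[2]) a, aeval_algebraMap_apply_eq_algebraMap_eval, eq_intCast]

/-- **HENSEL with a unit derivative** (Mathlib's `hensels_lemma`): an integer polynomial with `2 ∣ F(a)` and
`2 ∤ F'(a)` at an integer `a` has a root in `ℤ₂`. -/
theorem exists_padicInt_root (F : ℤ[X]) (a : ℤ) (hFa : (2 : ℤ) ∣ F.eval a)
    (hF'a : ¬ (2 : ℤ) ∣ (derivative F).eval a) : ∃ z : ℤ_[2], aeval z F = 0 := by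
  have h1 : ‖aeval (a : ℤ_[2]) F‖ < 1 := by
    rw [aeval_intCast_padicInt]
    exact (PadicInt.norm_int_lt_one_iff_dvd _).mpr (by exact_mod_cast hFa)
  have h2 : ‖aeval (a : ℤ_[2]) (derivative F)‖ = 1 := by
    rw [aeval_intCast_padicInt]
    refine le_antisymm (PadicInt.norm_le_one _) (not_lt.mp fun h => hF'a ?_)
    exact_mod_cast (PadicInt.norm_int_lt_one_iff_dvd _).mp h
  obtain ⟨z, hz, -⟩ := hensels_lemma (p := 2) (F := F) (a := (a : ℤ_[2])) (by rw [h2, one_pow]; exact h1)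
  exact ⟨z, hz⟩

/-- `17` is a FOURTH POWER in `ℚ₂` (`17 ≡ 1 mod 16`): Hensel on `G(Z) = ((2Z + 1)⁴ − 17)/8 =
2Z⁴ + 4Z³ + 3Z² + Z − 2` at `Z = 1` (`G(1) = 8`, `G'(1) = 27` odd). -/
theorem exists_fourth_root_seventeen : ∃ y : ℚ_[2], y ^ 4 = 17 := by
  obtain ⟨z, hz⟩ := exists_padicInt_root (C 2 * X ^ 4 + C 4 * X ^ 3 + C 3 * X ^ 2 + X - C 2) 1
    (by norm_num [derivative_C_mul_X_pow]) (by norm_num [derivative_C_mul_X_pow])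
  have hz' : 2 * z ^ 4 + 4 * z ^ 3 + 3 * z ^ 2 + z - 2 = 0 := by
    have := hz
    simp only [map_add, map_sub, map_mul, map_pow, aeval_X, map_ofNat] at this
    linear_combination this
  refine ⟨((2 * z + 1 : ℤ_[2]) : ℚ_[2]), ?_⟩
  have h : (2 * z + 1 : ℤ_[2]) ^ 4 = 17 := by linear_combination 8 * hz'
  exact_mod_cast congrArg ((↑) : ℤ_[2] → ℚ_[2]) h

/-- `17` is a SQUARE in `ℚ₂` (`17 ≡ 1 mod 8`): Hensel on `G(Z) = ((2Z + 1)² − 17)/4 = Z² + Z − 4` at `Z = 1`. -/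
theorem exists_sqrt_seventeen : ∃ y : ℚ_[2], y ^ 2 = 17 := by
  obtain ⟨z, hz⟩ := exists_padicInt_root (X ^ 2 + X - C 4) 1 (by norm_num) (by norm_num)
  have hz' : z ^ 2 + z - 4 = 0 := by
    have := hz
    simp only [map_add, map_sub, map_pow, aeval_X, map_ofNat] at this
    linear_combination this
  refine ⟨((2 * z + 1 : ℤ_[2]) : ℚ_[2]), ?_⟩
  have h : (2 * z + 1 : ℤ_[2]) ^ 2 = 17 := by linear_combination 4 * hz'
  exact_mod_cast congrArg ((↑) : ℤ_[2] → ℚ_[2]) h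

/-- the coefficient vector of the stratum-ρ1 member `Y⁴ + x·Y − 17·x²`: `c₀ = Y⁴`, `c₁ = Y`, `c₂ = −17`. -/
def rho1 (j : ℕ) : ℤ[X] := if j = 0 then X ^ 4 else if j = 1 then X else if j = 2 then C (-17) else 0

/-- `: rho1 0 = X ^ 4`. -/
theorem rho1_zero : rho1 0 = X ^ 4 := by simp [rho1]

/-- `: rho1 1 = X`. -/
theorem rho1_one : rho1 1 = X := by simp [rho1]

/-- `: rho1 2 = C (-17)`. -/
theorem rho1_two : rho1 2 = C (-17) := by simp [rho1]

/-- **STRATUM ρ1 (SUBSPACE) IS IN THE RESIDUE: `Y⁴ + x·Y − 17·x²` at `m₀ ≤ 2`.**  The violating hull pair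
`(c₀, c₂)` has slope `2/4`, top weight `8`, edge polynomial `f = W⁴ − 17`, `f_1 = 0`, `f_2 = W`; the root
`β = 17^{1/4} ∈ ℚ₂` (Hensel) is non-zero and simple, so (I) fails; (C) needs `L > 2μ ≥ 2` hence `f_2 = 0`: false;
(R) needs `L > s = 2` hence `f_2(β) = β = 0`: false.  (Its second Puiseux coefficient `−β²/68` is irrational: a
genuine `p`-adic-Subspace member — NOT claimed decidable here.) -/
theorem residue_rho1 {m₀ : ℕ} (hm : m₀ ≤ 2) : Residue m₀ 2 rho1 := by
  classical
  have hd0 : (rho1 0).natDegree = 4 := by rw [rho1_zero, natDegree_X_pow]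
  have hd1 : (rho1 1).natDegree = 1 := by rw [rho1_one, natDegree_X]
  have hd2 : (rho1 2).natDegree = 0 := by rw [rho1_two, natDegree_C]
  have h00 : rho1 0 ≠ 0 := by rw [rho1_zero]; exact pow_ne_zero _ X_ne_zero
  have h22 : rho1 2 ≠ 0 := by rw [rho1_two]; exact (map_ne_zero_iff C C_injective).mpr (by norm_num)
  intro hS
  have hgood : EdgeGood 2 rho1 2 4 := by
    have := hS 0 2 (by norm_num) le_rfl h00 h22 (by rw [hd0, hd2]; norm_num) (by rw [hd0, hd2]; omega)
      (by
        intro j hj _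
        rw [hd0, hd2]
        interval_cases j
        · rw [hd0]
        · rw [hd1]; norm_num
        · rw [hd2])
    rwa [hd0, hd2] at this
  obtain ⟨M, hT, hroots⟩ := hgood
  -- the support and the top weight `M = 8`
  have hS' : ∀ p ∈ ({(0, 4), (1, 1), (2, 0)} : Finset (ℕ × ℕ)), p.1 ≤ 2 := by
    intro p hp
    simp only [Finset.mem_insert, Finset.mem_singleton] at hp
    rcases hp with rfl | rfl | rfl <;> norm_num
  have hsupp : ∀ p : ℕ × ℕ, p.1 ≤ 2 → (rho1 p.1).coeff p.2 ≠ 0 →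
      p ∈ ({(0, 4), (1, 1), (2, 0)} : Finset (ℕ × ℕ)) := by
    rintro ⟨j, i⟩ hj hc
    dsimp only at hj hc
    simp only [Finset.mem_insert, Finset.mem_singleton, Prod.mk.injEq]
    interval_cases j
    · rw [rho1_zero, coeff_X_pow] at hc
      split_ifs at hc with h4
      · exact Or.inl ⟨rfl, h4⟩
      · exact (hc rfl).elim
    · rw [rho1_one, coeff_X] at hc
      split_ifs at hc with h1
      · exact Or.inr (Or.inl ⟨rfl, h1.symm⟩)
      · exact (hc rfl).elim
    · rw [rho1_two, coeff_C] at hc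
      split_ifs at hc with h0
      · exact Or.inr (Or.inr ⟨rfl, h0⟩)
      · exact (hc rfl).elim
  have h8 : 8 ≤ M := by
    have := hT.1 (0, 4) (mem_supp_of (by norm_num) (by rw [rho1_zero, coeff_X_pow, if_pos rfl]; norm_num))
    omega
  have hM : M = 8 := by
    by_contra hne
    apply hT.2
    rw [layerPoly_eq_sum 2 rho1 _ hS' hsupp, Finset.sum_eq_zero]
    intro p hp
    exfalso
    rw [Finset.mem_filter] at hp
    obtain ⟨hp1, hp2⟩ := hp
    simp only [Finset.mem_insert, Finset.mem_singleton] at hp1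
    rcases hp1 with rfl | rfl | rfl <;> norm_num at hp2 <;> omega
  subst hM
  have hf0 : layerPoly 2 rho1 2 4 8 0 = X ^ 4 + C (-17) := by
    rw [layerPoly_eq_sum 2 rho1 _ hS' hsupp, Finset.sum_filter, Finset.sum_insert (by decide),
      Finset.sum_insert (by decide), Finset.sum_singleton]
    have h04 : (rho1 0).coeff 4 = 1 := by rw [rho1_zero, coeff_X_pow, if_pos rfl]
    have h20 : (rho1 2).coeff 0 = -17 := by rw [rho1_two, coeff_C, if_pos rfl]
    norm_num [h04, h20]
  have hf2 : layerPoly 2 rho1 2 4 8 2 = X := by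
    rw [layerPoly_eq_sum 2 rho1 _ hS' hsupp, Finset.sum_filter, Finset.sum_insert (by decide),
      Finset.sum_insert (by decide), Finset.sum_singleton]
    have h11 : (rho1 1).coeff 1 = 1 := by rw [rho1_one, coeff_X, if_pos rfl]
    norm_num [h11]
  -- the root `β = 17^{1/4} ∈ ℚ₂`
  obtain ⟨y, hy⟩ := exists_fourth_root_seventeen
  have hβ4 : (algebraMap ℚ_[2] (PadicAlgCl 2) y) ^ 4 = 17 := by rw [← map_pow, hy, map_ofNat]
  have hβ0 : algebraMap ℚ_[2] (PadicAlgCl 2) y ≠ 0 := by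
    intro h
    rw [h, zero_pow four_ne_zero] at hβ4
    norm_num at hβ4
  have hroot : aeval (algebraMap ℚ_[2] (PadicAlgCl 2) y) (layerPoly 2 rho1 2 4 8 0) = 0 := by
    rw [hf0, map_add, map_pow, aeval_X, aeval_C, eq_intCast, hβ4]
    norm_num
  rcases hroots _ hβ0 hroot with hirr | ⟨L, hlay, hμL, -⟩ | ⟨-, L, hlay, hsL, -⟩
  · exact hirr y rfl
  · -- (C): `μ ≥ 1` forces `L ≥ 3`, but `f_2 = W ≠ 0`
    have hμ : 1 ≤ rootMult (layerPoly 2 rho1 2 4 8 0) (algebraMap ℚ_[2] (PadicAlgCl 2) y) := by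
      unfold rootMult
      refine (rootMultiplicity_pos ?_).mpr ?_
      · exact (Polynomial.map_ne_zero_iff (RingHom.injective_int _)).mpr hT.2
      · rw [IsRoot.def, ← aeval_eq_eval_map]
        exact hroot
    have := hlay 2 (by norm_num) (by omega)
    rw [hf2] at this
    exact X_ne_zero this
  · -- (R): `L > s = 2` forces `f_2(β) = β = 0`
    have := hlay 2 (by norm_num) hsL
    rw [hf2, aeval_X] at this
    exact hβ0 this

/-- at `m₀ ≥ 3` the slope `2/4` of ρ1 is not violating: the sector condition holds (vacuously at that pair). -/
theorem sectorCond_rho1 {m₀ : ℕ} (hm : 3 ≤ m₀) : SectorCond m₀ 2 rho1 := by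
  have hd0 : (rho1 0).natDegree = 4 := by rw [rho1_zero, natDegree_X_pow]
  have hd1 : (rho1 1).natDegree = 1 := by rw [rho1_one, natDegree_X]
  have hd2 : (rho1 2).natDegree = 0 := by rw [rho1_two, natDegree_C]
  have h22 : rho1 2 ≠ 0 := by rw [rho1_two]; exact (map_ne_zero_iff C C_injective).mpr (by norm_num)
  have h00 : rho1 0 ≠ 0 := by rw [rho1_zero]; exact pow_ne_zero _ X_ne_zero
  intro j₁ j₂ hlt hle h1 h2 hdlt hmv hhull
  have hj₂ : j₂ = 1 ∨ j₂ = 2 := by omega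
  rcases hj₂ with rfl | rfl
  · obtain rfl : j₁ = 0 := by omega
    have := hhull 2 le_rfl h22
    rw [hd0, hd1, hd2] at this
    omega
  · have hj₁ : j₁ = 0 ∨ j₁ = 1 := by omega
    rcases hj₁ with rfl | rfl
    · rw [hd0, hd2] at hmv
      omega
    · have := hhull 0 (by norm_num) h00
      rw [hd0, hd1, hd2] at this
      omega

/-- the coefficient vector of the stratum-ρ2 member `(Y² − 17x)² − x·Y = Y⁴ − 34x·Y² − x·Y + 289x²`. -/
def rho2 (j : ℕ) : ℤ[X] :=
  if j = 0 then X ^ 4 else if j = 1 then C (-34) * X ^ 2 - X else if j = 2 then C 289 else 0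

/-- `: rho2 0 = X ^ 4`. -/
theorem rho2_zero : rho2 0 = X ^ 4 := by simp [rho2]

/-- `: rho2 1 = C (-34) * X ^ 2 - X`. -/
theorem rho2_one : rho2 1 = C (-34) * X ^ 2 - X := by simp [rho2]

/-- `: rho2 2 = C 289`. -/
theorem rho2_two : rho2 2 = C 289 := by simp [rho2]

end Summit.Schanuel.Schanuel.Theorems.RootDecomp1KSectorTheorem
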